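import Literature.MathematicalPhysics.QuantumFieldTheory.Balaban1983to89.Setup
import Literature.MathematicalPhysics.QuantumFieldTheory.Balaban1983to89.B12Sect4Statements
import Literature.MathematicalPhysics.QuantumFieldTheory.Balaban1983to89.B12HjFree290

/-!
# `Balaban1983to89.B12Carve24Sect4PolarizationHyp` — [Balaban1987RG1] pp. 286–292 (Sect. 4, part 2: the consequences of
# the Ward–Takahashi identities (4.23)–(4.31), the group-covariance reduction (4.32)–(4.33), the table (4.34), the changes
# and resummations (4.35)–(4.37) defining the vacuum polarization tensor `Π`, the `β_j(g_{j−1})A`-term (4.38)–(4.45) and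
# the definition of the β-function, p. 292): P6 CARVING-FAN BLOCK 24 — the block's residual printed sentences in
# hypothesis form and ONE hypothesis bundle `Hyp` of the section's printed statements BY NAME, keyed to the consumer
# (`stmt-QuantumFields-20543`, K2⁷ `EndpointGivenBR13SepCoPH`, [B12]∕[B13]; also-feeds 20544)

statement-level skeleton of published theorems with citation tags; proofs where landed; nothing here is a claim about the
Yang–Mills mass gap

T. Bałaban, *Renormalization group approach to lattice gauge field theories. I. Generation of effective actions in a small
field approximation and a coupling constant renormalization in four dimensions*, Commun. Math. Phys. **109** (1987) 249–301,
doi:10.1007/bf01215223 `[Balaban1987RG1]` (cell paper "B12" = «[I]» of the later papers; journal page = PDF page + 248).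
STATUS: published, refereed.  PDF held: `paper:balaban1987-cmp109-rg-i-small-field`; pp. 286–292 [PDF 38–44] read by this
seat AS IMAGES (renders `run/shared/lean/pub/pub-balaban/b2b-balaban-ref1/pages/1987-cmp109-rg-I-small-field/…-p039-x2.png` …
`…-p044-x2.png`, 2026-08-28) and on the text layer (`p0038.txt` … `p0044.txt`, line locators `pNNNN.txt:Ln` below); pp. 289–292
also through the verbatim quotations of record in `B12WTReduction429`, `B12Marginal444`, `B12HjFree290`, `B12Chain290`,
`B12Eq439WilsonHessian`.  References of [I] used here: [7] = [Balaban1985Averaging] (B7), [10] = [Balaban1985Propagators]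
(B5∕B10 of the cell numbering, «(1.66) [10]», «(1.29)–(1.37) [10]»), [15] = [Balaban1985Variational] (B11).

CITATION HEADER (lean-in-tree rule).  Cell `lit-balaban` (HOME `run/shared/lean/pub/lit-balaban/`), P6 CARVING FAN
(D-0154 (3b)), block 24 of `carve/BLOCKS-21-30.md` (lead g30, READY 2026-08-28T05:30Z) = `carve/CARVE-LIST.md` § Block 24,
claimed by seat `carve-07` g4 under RULING #8 (`carve/STATUS.md` CLAIM 08:09:32Z, ERRATUM 08:09:58Z): «[B12] pp. 286–292,
Sect. 4 part 2: consequences of the identities, vacuum-polarization form (4.23)–(4.45); 9 SKELETON rows, all in tree; KEY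
stmt-QuantumFields-20543, also-feeds 20544; target this file».  Filed `--supports stmt-QuantumFields-20543`.  Neighbours:
block 23 `B12Carve23Sect4WardHyp` (pp. 281–286, (4.1)–(4.22): the (4.22)∕p. 286 statements of record it bundles are
`B12Sect4Statements.KernelBound422Printed`, `Display286Printed`, …, and its «irrelevant» currency is the (0.28)-predicate
`LocExpansion.IrrelevantBound` — BOTH RE-USED BELOW BY NAME), block 25 (Sect. 5 part 1, (5.1) ff.), block 26
`B12Carve26Sect5BetaHyp` (pp. 297–301).  RULES (`carve/CARVE-RULES.md` §2; RULING #9 (2)): IN TREE = CITE, NEVER RESTATE;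
residual printed statements in hypothesis form `def …Printed : Prop`; ONE bundle `Hyp`; no `instance`, no `notation`, 0 `sorry`.

## WHAT THE BLOCK'S PAGES PRINT AND WHERE THE TREE HOLDS IT (cite table — every SKELETON row of the block is IN TREE;
## nothing in this table is restated below)
* row B12.Eq4.23-4.29 — **(4.23)** p. 286 «B_{μ₃}(x) = (∂_{μ₃}λ_x)(x₃), λ_x(x₃) = Σ_ν (x_{3,ν} − x_ν)B_ν(x)» and «The first sum can be
  written as ⟨𝐄⁽⁴⁾, δB, B, B, ∂λ_x⟩»: `B12Marginal444.lamx` ∕ `lam`, `B12WTReduction429.eq423_affine` (λ_x(x) = 0, ∂λ_x = B(x) on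
  ℤ^Λ; the finite-torus MODEL NOTE there); **(4.24)** p. 287: `B12WTReduction429.eq424`; **(4.25)** and «In the first sum above we
  write again B_{μ₁}(x) = (∂_{μ₁}λ_x)(x₁), and by the first identity in (4.15) this sum equals 0»: `eq425`; «The second function in
  the term before the last is equal to k₂(iad_{B_{μ₁}(x₁)})²B_{μ₁}(x) = k₂iad_{B_{μ₁}(x₁)}i[B_{μ₁}(x₁), B_{μ₁}(x)] =
  k₂iad_{B_{μ₁}(x₁)}i[(∂B_{μ₁})(Γ_{x,x₁}), B_{μ₁}(x)]»: `eq_beforeLast`; «The first function in it is equal to −1∕2i[δB_μ(x), B_μ(x)],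
  because λ_x(x) = 0»: `kappa_oneSite`, `oneSite_br`; **(4.26)–(4.27)** with «where we have used again the equalities
  i[B_{μ₁}(x₁), (∂λ_x)_{μ₁}(x₁)] = i[B_{μ₁}(x₁), B_{μ₁}(x)] = i[(∂B_{μ₁})(Γ_{x,x₁}), B_{μ₁}(x)], λ_x(x) = 0»: `eq427` (EXACT, remainders
  `R₄, R₅, R₆`); **(4.28)** p. 288: `eq428` (EXACT, `R₇, R₈`); **(4.29)** «Thus the equalities (4.21), (4.24), and the simplified
  equalities (4.27), (4.28) yield …»: `eq429` (EXACT: the three printed 𝐄⁽²⁾-terms `2, −1, −3∕2` plus the NAMED remainders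
  `R₁ + ⋯ + R₁₁`), `eq429_atPoint`, `eq429_chart_of_bracket`, `eq429_chart_of_isSemisimple` (every hypothesis of the abstract
  identity discharged for 𝔤 semisimple), and the scalar-kernel right side `B12Marginal444.rhs429` (PROVED bookkeeping).
* row B12.Eq4.30-4.31 — **(4.30)** p. 288 (the lattice Taylor formula, «analogous to the formula (3.10) [7]») is USED in the
  tree as the split `B12WTReduction429.eq430_split` (third slot `B = B(x) + B(·, x) + B⁽²⁾`, the pieces as names `c`, `ℓ`,
  `B − c − ℓ`) with the linear term «B_{μ₃}(x₃, x) = Σ_ν (x_{3,ν} − x_ν)(∂_νB_{μ₃})(x)» = `B12Marginal444.Bxy`; the FORMULA (4.30)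
  itself («here ℓ and B − c − ℓ are just names — nothing about B(·, x) is used or proved», `B12WTReduction429` header) had no
  declaration: typed below in display shape (§1, `Taylor430Printed`); **(4.31)** p. 289 «Here, in the last equality, all
  fields and their derivatives are taken at the point x»: `B12WTReduction429.eq431` (EXACT: `1, 2, −1, −1` plus the NAMED
  remainders `S₁ + ⋯ + S₆`), `eq431_atPoint`, `eq431_chart_of_bracket`, `eq431_chart_of_isSemisimple`, `B12Marginal444.rhs431`.
* row B12.Eq4.32-4.33 — **(4.32)–(4.33)** p. 289 and «With our assumptions on the group G the identity (4.33) holds for E if and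
  only if E_ab is proportional to the identity matrix, E_ab = Eδ_ab, and then ⟨E, A⊗B⟩ = E tr AB»:
  `B12Schur433.hessian_chart_single_lieInvariant`, `exists_eq_mul_killingForm_of_killing_neg`, `hessian_chart_eq_sum_scalar_kernel`,
  `hessian_chart_eq_sum_scalar_kernel_killing` (PROVED: Schur for the Lie-invariant bilinear form on a simple 𝔤).
* row B12.Eq4.34 — **(4.34)** pp. 289–290 (the table: `⟨𝐄⁽²⁾(X), δB, B⟩` + the second-moment and first-moment groups, «+ (the
  irrelevant terms)», «The sums over x above are restricted to supp δB ⊂ □, and the sums over y are restricted to supp B ⊂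
  supp ζ̃_□») and the three sentences after it («is not analyzed yet» ∕ «already in an almost correct form» ∕ «By the Euclidean
  symmetries the third expression should vanish»): `B12Marginal444.eq434` (PROVED assembly of (4.20) = `sum420` from (4.29), (4.31)),
  `pairE`, `M1`, `M2`, `rhs434`, `block2`, `block3`; the moment sums `B12MomentSums434.moments434_latt`, `coeff434_latt`,
  `weighted434_le`.
* row B12.Eq4.35-4.37 — **(4.35)** p. 290, the replacement H_j(□₀) → H_j («yields the factor B₀exp(−δ₀M(L^jη)⁻¹) in a bound of
  the corresponding expression. Thus this change increases the sum of the irrelevant terms by the expression of the form (4.34),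
  but with very small coefficients»): `B12HjFree290.abs_sub_le`, `kernelBound_restr_sub` (the bound on H_j(□₀) − H_j is its NAMED
  HYPOTHESIS `hdiff` with a free small factor `η`; print's factor had no declaration — typed below, §1 `HjFreeFactor290Printed`,
  and fed to `kernelBound_restr_sub` by name), `sum_abs_restr_sub_le`, `twoPoint_latt_restr_sub`, `B12Chain290.replacement_error`;
  the y-extension to Z⁴ («This gives again the exponentially small coefficients»): `B12Chain290.yext_error`,
  `B12MomentSums434.tail434_latt`, `B12Cubes436.mem_suppZeta_of_l1_lt` ∕ `tail_suppZeta_le`, `B12WholeLattice290.M0x_sub_sum_le`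
  …; the X-extension and **(4.36)** («The expressions with localization domains, which do not satisfy this condition, are
  exponentially small in L^jη … hence, substituting it into (4.34), we get an irrelevant expression again»): `B12Ext436.ineq436`,
  `ineq436_printed`, `ineq436_delta1`, `B12Cubes436.ineq436_box_printed` ∕ `ineq436_box_l1`, `B12Ext436Lattice.ineq436_latt`,
  `B12Chain290.xext_error`, «because the other expressions do not depend on X»: `B12MomentSums434.fubini434`; **(4.37)** p. 291 «Π_{μ,ν}(x, y)
  = Σ_{X∈𝐃⁰_j} 𝐄⁽²⁾_{μ,ν}(X, x, y) … The function Π is called the vacuum polarization tensor»: `B12Ext436.twoPoint_summable`,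
  `B12Chain290.chain290` ∕ `chain290_sum` ∕ `chain290_moment0∕1∕2` (the p. 290∕291 chain as ONE inequality, PROVED modulo the
  named kernel hypotheses), the finite-volume body `B12PolarizationTensor120.polTensor` and (5.1) `B12Limit51`.
* row B12.Eq4.38-4.40 — **(4.38)–(4.39)** p. 291: `B12Eq439WilsonHessian.term438`, `eq439`, `eq439_plaq`, `curlPairing_partition`
  (PROVED), `B12Eq439PrintLetters`; **(4.40)** «β_j(g_{j−1})⟨∂^ξH_j, ∂^ξH_j⟩ = β_j(g_{j−1})Δ_j, where Δ_j is given by the explicit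
  formula (1.66) [10]»: `B12Interfaces.GaugeShift` (Seam 1: `constraintValues_eq`, `constraintInf_eq`, `isLeast_iff`, `comp`),
  `B12Eq440TorusKernel.eq440_torus`, `torKer_toT_eq_torusKernel`, `norm_DelK_sub_kerDeltaJ_le`.
* row B12.Eq4.41 — **(4.41)** p. 291 «Δ_{j,μν}(p′) = Δ₀(p′)δ_μν − ∂̄¹_μ(p′)∂¹_ν(p′) + (terms of higher order in p′)»:
  `B12Eq441DeltaJStructure.eq441_explicit` (the higher-order terms EXHIBITED and bounded uniformly in j), `rep441`,
  `taylorData3_kerDeltaJ`, `leading_eq_transverseSym`; `B12Eq441SymbolExpansion.symbDeltaJ`, `transverseSym`, `polarization`,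
  `symbDeltaJ_taylor`; `B12Eq443SymbolHessian.hess_eDir_eq_pderiv_transverse`; `B12Marginal444.transverse`.
* row B12.Eq4.42-4.45 — **(4.42)** p. 291: `B12Eq442DeltaJ.eq442`, `eq442_betaJ`, `eq442_remainder_bound`, `B12Marginal444.dens442`;
  **(4.43)–(4.44)**: `B12Eq443LatticeMoments.eq443`, `eq443_kdA`, `B12Moments443.moments443`, `block2x_of_taylorData3`,
  `B12Marginal444.block2_of_moments443`, `dens444`; **(4.45)** p. 292 «hence this term vanishes»: `B12Eq443LatticeMoments.eq445`,
  `B12Moments443.moments445`, `B12Marginal444.block3_eq_zero_of_moments445`, `curl`.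
* row B12.Txt@292 — p. 292 ll. 4–11 «Thus the only terms in the expansion of (4.38), which we do not control yet, more exactly
  for which the sum over j has not a uniform bound, are terms (4.42), (4.44). In the next section we will prove that the
  polarization tensor Π has a similar structure as the operator Δ_j, especially it has an expansion of the form (4.41), but with
  a coefficient. We define the β-function β_j(g_{j−1}) equal to this coefficient. The corresponding terms from (4.34) are equal to
  (4.42), (4.44) also, hence both groups of terms cancel, because (4.38) appears with the minus sign in the effective action
  (1.6).»: `B12Marginal444.marginal_eq_firstVar`, `firstVar_eq` (PROVED), `B12Eq442DeltaJ.cancel292_form`,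
  `cancel292_form_of_symmetries`, `cancel292_block2`, `cancel292_block3`; «We define the β-function … equal to this coefficient»:
  `B12BetaAsPrinted.Setting.β`, `B12BetaAsPrinted` (the as-printed Prop, `B12BetaAsPrinted.b12BetaAsPrinted_iff`), block 26's `B12Carve26Sect5BetaHyp.Hyp.t536`.

## WHAT THIS FILE ADDS
§1 THE RESIDUAL PRINTED SENTENCES with no statement-level declaration of record (searched 2026-08-28: `rg` over
`Balaban1983to89/B12*.lean` for «irrelevant», «4 + β», «(4.30)», «B₀exp»; hits only in module docstrings, the «NOT PROVED
HERE ∕ NOT TYPED» lists of `B12WTReduction429` («ANY bound — (4.17), (4.18), (4.22), "can be bounded as in (4.22)", i.e. the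
irrelevance of R₁, …, R₁₁, S₁, …, S₆ … the Taylor formula (4.30) itself»), `B12Marginal444` («the irrelevance of any dropped
term»), and the binder `hdiff` of `B12HjFree290`), typed in hypothesis form IN THE CURRENCY THE TREE ALREADY USES for
exactly these words — «irrelevant» = the (0.28)-predicate `LocExpansion.IrrelevantBound` (p. 281 ll. 5–7 «irrelevant according
to our terminology, i.e. they satisfy bounds of the form (0.28) on their domains of analyticity»; block 23's
`IrrelevantMltN282Printed` is the same predicate), «bounded as in (4.22)» = `B12Sect4Statements.KernelBound422Printed` on the
term's own `Data422` record — each with a kernel-checked companion: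
`BoundedAsIn422Printed` (p. 287 l. 14 «can be bounded as in (4.22)»; `.irrelevantBound` = «hence it is irrelevant»),
`Taylor430Printed` ((4.30), display shape), `Remainder430BoundPrinted` (p. 288 ll. 23–24, with the count behind «½|Γ_{x,x₃}|²»
PROVED: `norm_doubleSum_le_half_sq`, `remainder430Bound_of_termwise`), `Remainder430As422BetaPrinted` (p. 288 ll. 24–27
«the bound (4.22) with the power 4 + β instead of 5 in the last factor»; `.irrelevantBound` = «Hence this is an irrelevant
term»), `HjFreeFactor290Printed` (p. 290 ll. 19–21; `.kernelBound_restr_sub` feeds `B12HjFree290.kernelBound_restr_sub` BY NAME),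
and `irrelevantBound_finsetSum` («(the irrelevant terms)» of a display = ONE irrelevant term: the (0.28)-predicate is closed
under finite sums).
§2 THE BUNDLE.  `Carriers Φ W V` — the parameters the block's printed statements take (plain data over three type
PARAMETERS, no instances); `Hyp X` — the block's printed STATEMENTS as hypotheses BY NAME, one field per printed sentence
∕ display label; bookkeeping theorems `Hyp.secondSum425_irrelevant`, `Hyp.remainders429_irrelevant`,
`Hyp.remainder430_irrelevant`, `Hyp.remainders431_irrelevant`, `Hyp.hjFree_hdiff`, `hyp_iff`, and the
trivial inhabitant `hyp_trivial` (consistency of the bundle's shape; NOT a model of [I]).  The PROVED rows ((4.23)–(4.29) and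
(4.31) as exact identities, (4.32)–(4.34), (4.35)–(4.45), p. 292) enter nothing (theorems of the tree, cited above).

## HONEST SCOPE
Nothing of [I] is proved here beyond real arithmetic and bookkeeping: the irrelevance of the remainders of (4.24)–(4.31), the
(4.30) formula on print's contours, the (4.18)-estimate of its last term and the H_j(□₀) − H_j factor are HYPOTHESIS SLOTS
(print's analysis ∕ by reference to [7], [15]); the slots are typed in the schematic currency of the existing kernels
(`LocExpansion` over an abstract configuration type, `Data422` numbers, abstract points ∕ bonds, the abstract domain class of
`B12Ext436`) — the located content lives in the tree's model theorems cited above; no summit statement is proved by this seat;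
count-neutral; nothing continuum ∕ ℝ⁴ ∕ OS ∕ mass-gap ∕ Clay.  No `sorry`, no `instance`, no `notation`.
-/

noncomputable section

open Metric Finset
open scoped BigOperators

namespace Literature.MathematicalPhysics.QuantumFieldTheory.Balaban1983to89.B12Carve24Sect4PolarizationHyp

open B12Sect4Statements (Data422 KernelBound422Printed)
open B12Ext436 (DomainClass SiteGeometry)
open B12Decay510 (mixedDeriv)

/-! ## §1  Residual printed sentences of pp. 287–290 (hypothesis form) -/

/-- **p. 287 l. 14 [PDF 39]** (`p0039.txt:L14`, render `…-p039-x2.png`), the phrase «can be bounded as in (4.22)» (said of «The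
second sum» of (4.25); p. 287 l. 29 «is treated as in (4.25)» refers back to it), for ONE localized term of the expansion:
TYPED BY NAME as the tree's typed display (4.22) `B12Sect4Statements.KernelBound422Printed` ((4.22) p. 286: `lhs2 ≤
(32B₃(α₁∕α₂)c₀c₁)⁴ exp(−⅓κd_j(X)) (L^jη)⁵`) applied, for every localization domain `X` and every configuration `φ` of the
domain `𝒰` («on their domains of analyticity», p. 281 l. 7), to the block's (4.22)-record `K : Data422` with the term's modulus
`‖ℛ.E X φ‖` in the slot `lhs2` and `d_j(X)` in the slot `djX` (the other slots — `B₃, α₁, α₂, c₀(δ₁), c₁(δ₁), κ, L^jη` — are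
the printed constants of (4.22)).  `ℛ : LocExpansion Φ` = the term as a localized expansion (X ↦ its value on φ, (0.23)).
Whether print intends the identical constant or one of the same type is not displayed (p. 286 «bounds of the type (4.22),
although with a worse constant» is print's wording for the latter, NOT used on p. 287); typed as printed, «as in (4.22)».
[cite: Balaban1987RG1, p.287 l.14 with (4.22) p.286] -/
def BoundedAsIn422Printed {Φ : Type*} (ℛ : LocExpansion Φ) (𝒰 : Set Φ) (K : Data422) : Prop :=
  ∀ X φ, φ ∈ 𝒰 → KernelBound422Printed { K with lhs2 := ‖ℛ.E X φ‖, djX := ℛ.sys.dj X }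

/-- Unfolding (definitional): the term is at most `(32B₃(α₁∕α₂)c₀c₁)⁴ exp(−⅓κd_j(X)) (L^jη)⁵` on `𝒰`.
[cite: Balaban1987RG1, p.287 l.14 with (4.22) p.286] -/
theorem boundedAsIn422_iff {Φ : Type*} (ℛ : LocExpansion Φ) (𝒰 : Set Φ) (K : Data422) :
    BoundedAsIn422Printed ℛ 𝒰 K ↔ ∀ X φ, φ ∈ 𝒰 →
      ‖ℛ.E X φ‖ ≤ (32 * K.B₃ * (K.α₁ / K.α₂) * K.c₀ * K.c₁) ^ 4 * Real.exp (-(1 / 3 * K.κ * ℛ.sys.dj X)) * K.Ljη ^ 5 :=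
  Iff.rfl

/-- **«hence it is irrelevant»** (p. 287 ll. 14–15; also (4.22) p. 286 «hence this sum in (4.21) represents an irrelevant term»):
a term bounded as in (4.22) satisfies the (0.28)-predicate `LocExpansion.IrrelevantBound` with constant `(32B₃(α₁∕α₂)c₀c₁)⁴`,
`s = L^jη`, exponent `4 + 1` and rate `κ∕3`.  Real arithmetic, by name. [cite: Balaban1987RG1, p.287 ll.14–15, (0.28) p.258] -/
theorem BoundedAsIn422Printed.irrelevantBound {Φ : Type*} {ℛ : LocExpansion Φ} {𝒰 : Set Φ} {K : Data422}
    (h : BoundedAsIn422Printed ℛ 𝒰 K) :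
    ℛ.IrrelevantBound 𝒰 ((32 * K.B₃ * (K.α₁ / K.α₂) * K.c₀ * K.c₁) ^ 4) K.Ljη 1 (K.κ / 3) := by
  intro X φ hφ
  have h1 : ‖ℛ.E X φ‖ ≤ (32 * K.B₃ * (K.α₁ / K.α₂) * K.c₀ * K.c₁) ^ 4 *
      Real.exp (-(1 / 3 * K.κ * ℛ.sys.dj X)) * K.Ljη ^ 5 := h X φ hφ
  have e1 : K.Ljη ^ ((4 : ℝ) + 1) = K.Ljη ^ (5 : ℕ) := by
    rw [show (4 : ℝ) + 1 = ((5 : ℕ) : ℝ) by norm_num, Real.rpow_natCast]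
  have e2 : Real.exp (-(K.κ / 3) * ℛ.sys.dj X) = Real.exp (-(1 / 3 * K.κ * ℛ.sys.dj X)) := by
    congr 1; ring
  rw [e1, e2]
  exact h1.trans_eq (by ring)

/-- **(4.30) p. 288 [PDF 40]** (`p0040.txt:L16–L22`, render `…-p040-x2.png`), verbatim: «Again, we apply the procedure in (4.21),
but we expand the last factor up to second order around the point x. We have the following Taylor's formula on a unit lattice,
analogous to the formula (3.10) [7]
  f(y) = f(x) + Σ_{μ=1}^{d} (y_μ − x_μ)(∂_μ f)(x) + Σ_{μ=1}^{d} Σ_{x′∈[Γ_{x,y}[_μ} Σ_{b∈Γ_{x,x′}} (∂∂_μ f)(b),   (4.30)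
where [Γ_{x,y}[_μ denotes the part of the contour Γ_{x,y} parallel to the μ-th axis, including the initial point and excluding
the final point. This formula is applied to the function B_{μ₃}(x₃) at y = x₃.»  TYPED IN DISPLAY SHAPE over abstract carriers
(the conventions of the contours Γ and of ∂, ∂∂ on their negatively oriented parts are those of (3.25)–(3.32) [7] and p. 285,
carried by the data, not fixed here): points `P` of the unit lattice with integer coordinates `coord`, a field `f : P → V`, its
lattice derivatives `df μ` (= ∂_μ f, at points) and `ddf μ` (= ∂∂_μ f, at bonds `Bd`), `axisPart μ x y` = the points of
[Γ_{x,y}[_μ, `contour x x′` = the bonds of Γ_{x,x′}.  In the tree the formula is USED as the split `B12WTReduction429.eq430_split`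
(its three pieces as names) with the linear term `B12Marginal444.Bxy`; the identity itself (lattice calculus: a twice-iterated
telescoping along the contour) is a hypothesis slot here, not proved. [cite: Balaban1987RG1, (4.30) p.288] -/
def Taylor430Printed {P V Bd : Type*} [AddCommGroup V] {d : ℕ} (coord : P → Fin d → ℤ) (f : P → V)
    (df : Fin d → P → V) (ddf : Fin d → Bd → V) (axisPart : Fin d → P → P → Finset P)
    (contour : P → P → Finset Bd) : Prop :=
  ∀ x y, f y = f x + ∑ μ, (coord y μ - coord x μ) • df μ x + ∑ μ, ∑ x' ∈ axisPart μ x y, ∑ b ∈ contour x x', ddf μ b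

/-- **p. 288 ll. 23–24 [PDF 40]** (`p0040.txt:L23–L24`, render `…-p040-x2.png`), verbatim: «By (4.18) the last term on the
right-hand side can be estimated by ½|Γ_{x,x₃}|²α₁(L^jη)^{2+β} with a positive β.»  TYPED over explicit carriers in the style of
`B12Sect4Statements.PointData286`: points `P` (x, x₃ of the unit lattice in □̃⁴), `b2 x x₃` = the modulus of the last term
B⁽²⁾_{μ₃} of (4.30) for `f = B_{μ₃}`, `y = x₃` (index suppressed, one statement per index as in the lineage), `len x x₃ =
|Γ_{x,x₃}| = |x₃ − x|` (the field `len` of `PointData286`), `α₁` of (4.17)∕(4.18), `Ljη = L^jη`, and the printed «positive β»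
((4.18) p. 285: «|(∂_λ∂_νB_μ)(x)| < α₁(L^jη)^{2+β}, 0 ≦ β ≦ β₀ < 1», in tree `B12Ineq418Flat` ∕ `B12Ineq418Regular` ∕
`B12Ineq418DeltaB`). [cite: Balaban1987RG1, p.288 ll.23–24] -/
def Remainder430BoundPrinted {P : Type*} (b2 len : P → P → ℝ) (α₁ Ljη β : ℝ) : Prop :=
  0 < β ∧ ∀ x x₃, b2 x x₃ ≤ 1 / 2 * len x x₃ ^ 2 * α₁ * Ljη ^ ((2 : ℝ) + β)

/-- The count behind «½|Γ_{x,x₃}|²»: `Σ_{k<n} k ≤ ½n²`. Real arithmetic. [cite: Balaban1987RG1, p.288 ll.23–24 (bookkeeping)] -/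
theorem sum_range_natCast_le_half_sq (n : ℕ) : ∑ k ∈ Finset.range n, (k : ℝ) ≤ 1 / 2 * (n : ℝ) ^ 2 := by
  induction n with
  | zero => simp
  | succ n ih =>
    rw [Finset.sum_range_succ]
    push_cast
    nlinarith [ih]

/-- **Where «½|Γ_{x,x₃}|²» comes from.**  The last term of (4.30) is a double sum: over the points `x′` of the contour
Γ_{x,x₃} — the k-th point, `k < n = |Γ_{x,x₃}|`, being joined to `x` by the `k` bonds of Γ_{x,x′} — of the bond terms
(∂∂_μ f)(b); if every bond term has norm at most `a` (print: (4.18), `a = α₁(L^jη)^{2+β}`), the double sum has norm at most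
`Σ_{k<n} k·a ≤ ½n²a`.  Real arithmetic over any seminormed group. [cite: Balaban1987RG1, p.288 ll.23–24 (bookkeeping)] -/
theorem norm_doubleSum_le_half_sq {V : Type*} [SeminormedAddCommGroup V] (n : ℕ) (g : ℕ → ℕ → V) {a : ℝ}
    (ha : 0 ≤ a) (hg : ∀ k < n, ∀ i < k, ‖g k i‖ ≤ a) :
    ‖∑ k ∈ Finset.range n, ∑ i ∈ Finset.range k, g k i‖ ≤ 1 / 2 * (n : ℝ) ^ 2 * a := by
  calc ‖∑ k ∈ range n, ∑ i ∈ range k, g k i‖ ≤ ∑ k ∈ range n, ‖∑ i ∈ range k, g k i‖ := norm_sum_le _ _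
    _ ≤ ∑ k ∈ range n, ((k : ℝ) * a) := by
        refine Finset.sum_le_sum fun k hk => (norm_sum_le _ _).trans ?_
        calc ∑ i ∈ range k, ‖g k i‖ ≤ ∑ i ∈ range k, a :=
              Finset.sum_le_sum fun i hi => hg k (mem_range.1 hk) i (mem_range.1 hi)
          _ = k * a := by rw [Finset.sum_const, card_range, nsmul_eq_mul]
    _ = (∑ k ∈ range n, (k : ℝ)) * a := by rw [Finset.sum_mul]
    _ ≤ 1 / 2 * (n : ℝ) ^ 2 * a := mul_le_mul_of_nonneg_right (sum_range_natCast_le_half_sq n) ha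

/-- **«By (4.18) the last term on the right-hand side can be estimated by ½|Γ_{x,x₃}|²α₁(L^jη)^{2+β}»** — DERIVED from a
termwise (4.18)-bound: if, for every pair (x, x₃), the modulus `b2 x x₃` is that of a double sum over the `nlen x x₃ = |Γ_{x,x₃}|`
contour points (the k-th carrying k bond terms) whose bond terms are at most `α₁(L^jη)^{2+β}` in norm ((4.18) p. 285), with
`α₁, L^jη ≥ 0` and `β > 0`, then `Remainder430BoundPrinted` holds with `len = nlen`. [cite: Balaban1987RG1, p.288 ll.23–24
with (4.18) p.285] -/
theorem remainder430Bound_of_termwise {P V : Type*} [SeminormedAddCommGroup V] (nlen : P → P → ℕ)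
    (dd : P → P → ℕ → ℕ → V) (b2 len : P → P → ℝ) {α₁ Ljη β : ℝ} (hα₁ : 0 ≤ α₁) (hL : 0 ≤ Ljη) (hβ : 0 < β)
    (hlen : ∀ x x₃, len x x₃ = nlen x x₃)
    (hb2 : ∀ x x₃, b2 x x₃ = ‖∑ k ∈ Finset.range (nlen x x₃), ∑ i ∈ Finset.range k, dd x x₃ k i‖)
    (h418 : ∀ x x₃ k i, ‖dd x x₃ k i‖ ≤ α₁ * Ljη ^ ((2 : ℝ) + β)) :
    Remainder430BoundPrinted b2 len α₁ Ljη β := by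
  refine ⟨hβ, fun x x₃ => ?_⟩
  have ha : 0 ≤ α₁ * Ljη ^ ((2 : ℝ) + β) := mul_nonneg hα₁ (Real.rpow_nonneg hL _)
  rw [hb2, hlen]
  calc ‖∑ k ∈ range (nlen x x₃), ∑ i ∈ range k, dd x x₃ k i‖
      ≤ 1 / 2 * (nlen x x₃ : ℝ) ^ 2 * (α₁ * Ljη ^ ((2 : ℝ) + β)) :=
        norm_doubleSum_le_half_sq (nlen x x₃) (dd x x₃) ha fun k _ i _ => h418 x x₃ k i
    _ = 1 / 2 * (nlen x x₃ : ℝ) ^ 2 * α₁ * Ljη ^ ((2 : ℝ) + β) := by ring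

/-- **p. 288 ll. 24–27 [PDF 40]** (`p0040.txt:L24–L27`, render `…-p040-x2.png`), verbatim: «For the expression ⟨𝐄⁽³⁾, B, B, B⁽²⁾⟩
⟦sic; the term is `⟨𝐄⁽³⁾, δB, B, B⁽²⁾⟩`, the remainder `S₁ = ⟨E3, δB, B, B − c − ℓ⟩` of `B12WTReduction429.eq431`⟧, with this
last term inserted in the place of B⁽²⁾, it implies the bound (4.22) with the power 4 + β instead of 5 in the last factor.»
TYPED literally: the display (4.22) (`B12Sect4Statements.KernelBound422Printed`, p. 286) with its last factor `(L^jη)⁵` replaced by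
`(L^jη)^{4+β}`, for the term `ℛ : LocExpansion Φ` on the domain `𝒰`, over the block's (4.22)-record `K` (slots as in
`BoundedAsIn422Printed`). [cite: Balaban1987RG1, p.288 ll.24–27 with (4.22) p.286] -/
def Remainder430As422BetaPrinted {Φ : Type*} (ℛ : LocExpansion Φ) (𝒰 : Set Φ) (K : Data422) (β : ℝ) : Prop :=
  ∀ X φ, φ ∈ 𝒰 → ‖ℛ.E X φ‖ ≤
    (32 * K.B₃ * (K.α₁ / K.α₂) * K.c₀ * K.c₁) ^ 4 * Real.exp (-(1 / 3 * K.κ * ℛ.sys.dj X)) * K.Ljη ^ ((4 : ℝ) + β)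

/-- **«Hence this is an irrelevant term.»** (p. 288 ll. 26–27): the (4.22)-bound with the power 4 + β is the (0.28)-predicate
`LocExpansion.IrrelevantBound` with constant `(32B₃(α₁∕α₂)c₀c₁)⁴`, `s = L^jη`, exponent `4 + β` and rate `κ∕3`.  Real
arithmetic, by name. [cite: Balaban1987RG1, p.288 ll.26–27, (0.28) p.258] -/
theorem Remainder430As422BetaPrinted.irrelevantBound {Φ : Type*} {ℛ : LocExpansion Φ} {𝒰 : Set Φ} {K : Data422} {β : ℝ}
    (h : Remainder430As422BetaPrinted ℛ 𝒰 K β) :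
    ℛ.IrrelevantBound 𝒰 ((32 * K.B₃ * (K.α₁ / K.α₂) * K.c₀ * K.c₁) ^ 4) K.Ljη β (K.κ / 3) := by
  intro X φ hφ
  have e2 : Real.exp (-(K.κ / 3) * ℛ.sys.dj X) = Real.exp (-(1 / 3 * K.κ * ℛ.sys.dj X)) := by
    congr 1; ring
  rw [e2]
  exact (h X φ hφ).trans_eq (by ring)

/-- **p. 290 ll. 19–21 [PDF 42]** (`p0042.txt:L19–L21`, render `…-p042-x2.png`), verbatim: «If we replace H_j(□₀) by H_j with free
boundary conditions, then the difference H_j(□₀) − H_j restricted to X × supp ζ̃_□, yields the factor B₀exp(−δ₀M(L^jη)⁻¹) in a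
bound of the corresponding expression.»  TYPED in exactly the binder shape in which the tree's replacement kernel consumes it —
the hypothesis `hdiff` of `B12HjFree290.kernelBound_restr_sub` (READING (F) there: «‖h⁰_X(x) − h_X(x)‖ ≤ ηe^{−δ₀dist(x,X)} on S;
print: η = B₃·B₀e^{−δ₀M(L^jη)^{−1}}, here η ≥ 0 free») WITH THE PRINTED FACTOR: for every localization domain `X` and every
site `x ∈ S` (S = supp ζ̃_□), `‖h₀ X x − h X x‖ ≤ B₀exp(−δ₀M(L^jη)⁻¹) · (B₃ exp(−δ₀ dist(x, X)))` — the p. 282 response bound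
`B₃exp(−δ₀dist^{(ξ)}(x, X))` of H_j(□₀) (hypothesis `hh₀` there) times the factor.  Carriers: localization domains `Dom`, sites
`Λ`, response space `W`, the responses `h₀` (of H_j(□₀)) and `h` (of H_j), `S`, `distD x X = dist^{(ξ)}(x, X)`, the constants
`B₃` (p. 282), `B₀`, `δ₀`, the cube size `M` and `Ljη = L^jη`.  The bound itself is print's claim about 𝐇_j of [15]
(Sect. G), used on p. 290 without display — a hypothesis slot, not derived. [cite: Balaban1987RG1, p.290 ll.19–21] -/
def HjFreeFactor290Printed {Dom Λ W : Type*} [NormedAddCommGroup W] (h₀ h : Dom → Λ → W) (S : Set Λ)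
    (distD : Λ → Dom → ℝ) (B₃ B₀ δ₀ M Ljη : ℝ) : Prop :=
  ∀ X, ∀ x ∈ S, ‖h₀ X x - h X x‖ ≤
    B₀ * Real.exp (-(δ₀ * (M * Ljη⁻¹))) * (B₃ * Real.exp (-δ₀ * distD x X))

/-- The printed factor IS the hypothesis `hdiff` of `B12HjFree290` with `η = B₃·B₀e^{−δ₀M(L^jη)⁻¹}` (reshaping only).
[cite: Balaban1987RG1, p.290 ll.19–21] -/
theorem HjFreeFactor290Printed.hdiff {Dom Λ W : Type*} [NormedAddCommGroup W] {h₀ h : Dom → Λ → W} {S : Set Λ}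
    {distD : Λ → Dom → ℝ} {B₃ B₀ δ₀ M Ljη : ℝ} (hf : HjFreeFactor290Printed h₀ h S distD B₃ B₀ δ₀ M Ljη) :
    ∀ X, ∀ x ∈ S, ‖h₀ X x - h X x‖ ≤
      B₃ * (B₀ * Real.exp (-(δ₀ * (M * Ljη⁻¹)))) * Real.exp (-δ₀ * distD x X) :=
  fun X x hx => (hf X x hx).trans_eq (by ring)

/-- **«Thus this change increases the sum of the irrelevant terms by the expression of the form (4.34), but with very small
coefficients»** (p. 290 ll. 21–23) — BY NAME: the printed factor, fed to the tree's `B12HjFree290.kernelBound_restr_sub` over the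
abstract domain class `G` and site geometry `Γ` of `B12Ext436` (its other hypotheses — analyticity of `E_X` on the (4.4)-ball,
(1.18) there, the (4.35) representation of both kernels, the p. 282 bounds of both response families — passed through
unchanged), gives the two-sided kernel bound of the S × S-restricted difference of the (4.35) kernels with the constant
`8E₀α₂⁻²B₃ · (B₃·B₀e^{−δ₀M(L^jη)⁻¹})`. [cite: Balaban1987RG1, (4.35) p.290 ll.19–23] -/
theorem HjFreeFactor290Printed.kernelBound_restr_sub {G : DomainClass} {Λ W : Type*} [NormedAddCommGroup W]
    [NormedSpace ℂ W] (Γ : SiteGeometry G Λ) (EX : G.Dom → W → ℂ) (h₀ h : G.Dom → Λ → W)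
    (E2₀ E2 : G.Dom → Λ → Λ → ℝ) {S : Set Λ} {α₂ E₀ B₃ B₀ δ₀ M Ljη κ : ℝ} (hα₂ : 0 < α₂) (hE₀ : 0 ≤ E₀)
    (hB₃ : 0 ≤ B₃) (hB₀ : 0 ≤ B₀)
    (han : ∀ X, AnalyticOnNhd ℂ (EX X) (ball 0 α₂))
    (h118 : ∀ X, ∀ v ∈ ball (0 : W) α₂, ‖EX X v‖ ≤ E₀ * Real.exp (-κ * G.dj X))
    (hrepr₀ : ∀ X x y, E2₀ X x y = (mixedDeriv (EX X) (h₀ X x) (h₀ X y)).re)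
    (hrepr : ∀ X x y, E2 X x y = (mixedDeriv (EX X) (h X x) (h X y)).re)
    (hh₀ : ∀ X x, ‖h₀ X x‖ ≤ B₃ * Real.exp (-δ₀ * Γ.distD x X))
    (hh : ∀ X x, ‖h X x‖ ≤ B₃ * Real.exp (-δ₀ * Γ.distD x X))
    (hf : HjFreeFactor290Printed h₀ h S Γ.distD B₃ B₀ δ₀ M Ljη) :
    Γ.KernelBound (fun X x y => (S ×ˢ S).indicator (fun p : Λ × Λ => E2₀ X p.1 p.2 - E2 X p.1 p.2) (x, y))
      (8 * E₀ / α₂ ^ 2 * B₃ * (B₃ * (B₀ * Real.exp (-(δ₀ * (M * Ljη⁻¹)))))) κ δ₀ :=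
  B12HjFree290.kernelBound_restr_sub Γ EX h₀ h E2₀ E2 hα₂ hE₀ hB₃ (by positivity) han h118 hrepr₀ hrepr hh₀ hh
    hf.hdiff

/-- **«+ (the irrelevant terms)»** (the display labels of (4.26)–(4.29), (4.31), (4.34)): the (0.28)-predicate is closed under
finite sums on a common system of localization domains — finitely many irrelevant terms with constants `C i` (same `s`,
exponent and rate) add up to ONE irrelevant term with constant `Σ C i`.  Norm bookkeeping.
[cite: Balaban1987RG1, (4.29) p.288, (4.31) p.289, (0.28) p.258 (bookkeeping)] -/
theorem irrelevantBound_finsetSum {Φ ι : Type*} (sys : LocDomainSys) (R : ι → sys.Dom → Φ → ℂ) (s : Finset ι)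
    (𝒰 : Set Φ) (C : ι → ℝ) (sL α κ : ℝ)
    (h : ∀ i ∈ s, (⟨sys, R i⟩ : LocExpansion Φ).IrrelevantBound 𝒰 (C i) sL α κ) :
    (⟨sys, fun X φ => ∑ i ∈ s, R i X φ⟩ : LocExpansion Φ).IrrelevantBound 𝒰 (∑ i ∈ s, C i) sL α κ := by
  intro X φ hφ
  show ‖∑ i ∈ s, R i X φ‖ ≤ (∑ i ∈ s, C i) * sL ^ (4 + α) * Real.exp (-κ * sys.dj X)
  calc ‖∑ i ∈ s, R i X φ‖ ≤ ∑ i ∈ s, ‖R i X φ‖ := norm_sum_le _ _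
    _ ≤ ∑ i ∈ s, C i * sL ^ (4 + α) * Real.exp (-κ * sys.dj X) :=
        Finset.sum_le_sum fun i hi => h i hi X φ hφ
    _ = (∑ i ∈ s, C i) * sL ^ (4 + α) * Real.exp (-κ * sys.dj X) := by rw [Finset.sum_mul, Finset.sum_mul]

/-! ## §2  The bundle: the printed statements of pp. 286–292 as hypotheses, by name -/

/-- **Carriers of the block-24 bundle** — plain data over three type PARAMETERS: `Φ` = the (complex) configurations on which
the localized terms of (4.20) depend (the carrier of `LocExpansion`, (0.23) p. 257), `W` = the complex normed space of the
responses ⟨(δ∕δB)𝐇_j(□₀, 0), δ_x⟩ ∕ of H_j (the carrier of `B12HjFree290`), `V` = the value group of the fields `B_{μ₃}` in the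
Taylor formula (4.30).  Fields, one per parameter of the block's printed statements: the system `sys` of localization domains
X ∈ 𝐃_j, X ⊂ □̃² for the fixed cube □ (p. 290) with d_j, the domain `𝒰` («on their domains of analyticity»), `Ljη = L^jη`,
the (0.28)-exponent `αI` and rate `κI` of the displays' «(the irrelevant terms)» (constants not displayed), the (4.22)-record
`K422` (constants `B₃, α₁, α₂, c₀, c₁, κ`; its `lhs2`, `djX` slots are overwritten term by term); the NAMED REMAINDERS of the
tree's exact identities as localized terms: `R i` (`i : Fin 10`) = `R_{i+2}` of `B12WTReduction429.eq429` (R₂ = −2⟨E2, q″, B − c⟩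
«the second sum» of (4.25); R₃ «the term before the last»; R₄, R₅, R₆ of (4.26)–(4.27); R₇, R₈ of (4.28); R₉, R₁₀, R₁₁ «replacing
all fields B by their values at the point x»; R₁ = the second sum of (4.21) is block 23's (4.22)) with (0.28)-constants `CR i`,
and `S i` (`i : Fin 6`) = `S_{i+1}` of `eq431` with constants `CS i` and the «positive β» of p. 288; the (4.30) data: points `P`
with coordinates `coord` (d = 4), bonds `Bd`, the contour data `axisPart`, `contour`, the field `fB` (= B_{μ₃}) with `dfB`,
`ddfB`, and the point functions `b2`, `len`, the constant `α₁`; the p. 290 data: domains `DomH`, sites `ΛH`, responses `h₀`,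
`h`, `SH` = supp ζ̃_□, `distH`, constants `B₃`, `B₀`, `δ₀`, `M`. [cite: Balaban1987RG1, (4.23)–(4.45) pp.286–292] -/
structure Carriers (Φ W V : Type*) where
  sys : LocDomainSys
  𝒰 : Set Φ
  Ljη : ℝ
  αI : ℝ
  κI : ℝ
  K422 : Data422
  R : Fin 10 → sys.Dom → Φ → ℂ
  CR : Fin 10 → ℝ
  S : Fin 6 → sys.Dom → Φ → ℂ
  CS : Fin 6 → ℝ
  β : ℝ
  P : Type
  Bd : Type
  coord : P → Fin 4 → ℤ
  axisPart : Fin 4 → P → P → Finset P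
  contour : P → P → Finset Bd
  fB : P → V
  dfB : Fin 4 → P → V
  ddfB : Fin 4 → Bd → V
  b2 : P → P → ℝ
  len : P → P → ℝ
  α₁ : ℝ
  DomH : Type
  ΛH : Type
  h₀ : DomH → ΛH → W
  h : DomH → ΛH → W
  SH : Set ΛH
  distH : ΛH → DomH → ℝ
  B₃ : ℝ
  B₀ : ℝ
  δ₀ : ℝ
  M : ℝ

namespace Carriers

variable {Φ W V : Type*}

/-- The localized term with kernel `T` on the block's system of localization domains, as a `LocExpansion` ((0.23)).
[cite: Balaban1987RG1, (0.23) p.257, (4.20) p.285] -/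
abbrev term (X : Carriers Φ W V) (T : X.sys.Dom → Φ → ℂ) : LocExpansion Φ := ⟨X.sys, T⟩

end Carriers

/-- **BLOCK 24 OF [B12] AS ONE HYPOTHESIS BUNDLE** (pp. 286–292 [PDF 38–44]): the printed statements of the block that are
hypothesis-shaped, BY NAME, one field per printed sentence ∕ display label —
`secondSum425` = p. 287 l. 14 «The second sum can be bounded as in (4.22), hence it is irrelevant» (R₂; `BoundedAsIn422Printed`);
`beforeLast425` = p. 287 ll. 15–17 «hence this term is irrelevant also» (R₃; the identity is `B12WTReduction429.eq_beforeLast`);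
`irrelevant427` = (4.26)–(4.27) p. 287 «+ (the irrelevant term(s))» with l. 29 «is treated as in (4.25), hence it is irrelevant»
(R₄, R₅, R₆); `irrelevant428` = p. 287 l. 33 «This term with the function −1∕2i[B, ∂λ_x] is irrelevant, by the equality written
after (4.26)» and (4.28) p. 288 «+ (the irrelevant term)» (R₇, R₈); `pointValues429` = p. 288 ll. 10–12 «replacing all fields B
by their values at the point x. The difference B(·) − B(x) = (∂B)(Γ_{x,·}) gives rise to irrelevant terms» (R₉, R₁₀, R₁₁) —
«irrelevant» = the (0.28)-predicate `LocExpansion.IrrelevantBound` (p. 281 ll. 5–7), constants `CR i`, exponent `αI`, rate `κI`;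
`taylor430` = (4.30) p. 288 (`Taylor430Printed`); `remainder430` = p. 288 ll. 23–24 (`Remainder430BoundPrinted`);
`remainder430As422` = p. 288 ll. 24–27 (S₁; `Remainder430As422BetaPrinted`); `irrelevant431` = (4.31) p. 289 «+ (the irrelevant
term(s))» (S₂, …, S₆); `hjFree290` = p. 290 ll. 19–21 (`HjFreeFactor290Printed`).  The EXACT identities (4.23)–(4.29), (4.31),
the Schur step (4.32)–(4.33), the table (4.34), the chain (4.35)–(4.37), (4.38)–(4.45) and the p. 292 cancellation are PROVED
in tree (module docstring's table) and take no slot; (4.22), the p. 286 statements and (4.5) are block 23's bundle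
(`B12Carve23Sect4WardHyp.Hyp`).  Hypothesis slots only; nothing asserted. [cite: Balaban1987RG1, (4.23)–(4.45) pp.286–292] -/
structure Hyp {Φ W V : Type*} [NormedAddCommGroup W] [AddCommGroup V] (X : Carriers Φ W V) : Prop where
  /-- p. 287 l. 14 — R₂, «bounded as in (4.22)»: `B12Sect4Statements.KernelBound422Printed` by name. -/
  secondSum425 : BoundedAsIn422Printed (X.term (X.R 0)) X.𝒰 X.K422
  /-- p. 287 ll. 15–17 — R₃ «irrelevant also»: `LocExpansion.IrrelevantBound`. -/
  beforeLast425 : (X.term (X.R 1)).IrrelevantBound X.𝒰 (X.CR 1) X.Ljη X.αI X.κI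
  /-- (4.26)–(4.27) p. 287 — R₄, R₅, R₆. -/
  irrelevant427 : ∀ i : Fin 10, 2 ≤ i.val → i.val ≤ 4 → (X.term (X.R i)).IrrelevantBound X.𝒰 (X.CR i) X.Ljη X.αI X.κI
  /-- p. 287 l. 33 and (4.28) p. 288 — R₇, R₈. -/
  irrelevant428 : ∀ i : Fin 10, 5 ≤ i.val → i.val ≤ 6 → (X.term (X.R i)).IrrelevantBound X.𝒰 (X.CR i) X.Ljη X.αI X.κI
  /-- p. 288 ll. 10–12 — R₉, R₁₀, R₁₁. -/
  pointValues429 : ∀ i : Fin 10, 7 ≤ i.val → (X.term (X.R i)).IrrelevantBound X.𝒰 (X.CR i) X.Ljη X.αI X.κI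
  /-- (4.30) p. 288 for `f = B_{μ₃}`. -/
  taylor430 : Taylor430Printed X.coord X.fB X.dfB X.ddfB X.axisPart X.contour
  /-- p. 288 ll. 23–24. -/
  remainder430 : Remainder430BoundPrinted X.b2 X.len X.α₁ X.Ljη X.β
  /-- p. 288 ll. 24–27 — S₁, «the bound (4.22) with the power 4 + β instead of 5». -/
  remainder430As422 : Remainder430As422BetaPrinted (X.term (X.S 0)) X.𝒰 X.K422 X.β
  /-- (4.31) p. 289 — S₂, …, S₆. -/
  irrelevant431 : ∀ i : Fin 6, 1 ≤ i.val → (X.term (X.S i)).IrrelevantBound X.𝒰 (X.CS i) X.Ljη X.αI X.κI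
  /-- p. 290 ll. 19–21 — the H_j(□₀) − H_j factor: the `hdiff` of `B12HjFree290.kernelBound_restr_sub`. -/
  hjFree290 : HjFreeFactor290Printed X.h₀ X.h X.SH X.distH X.B₃ X.B₀ X.δ₀ X.M X.Ljη

/-! ## §3  Bookkeeping over the bundle (kernel-checked uses of the cited declarations; no statement asserted) -/

section Bookkeeping

variable {Φ W V : Type*} [NormedAddCommGroup W] [AddCommGroup V] {X : Carriers Φ W V}

/-- The bundle is the conjunction of its eleven printed members (definitional). [cite: Balaban1987RG1, (4.23)–(4.45) pp.286–292
(bookkeeping)] -/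
theorem hyp_iff (X : Carriers Φ W V) :
    Hyp X ↔
      BoundedAsIn422Printed (X.term (X.R 0)) X.𝒰 X.K422 ∧
      (X.term (X.R 1)).IrrelevantBound X.𝒰 (X.CR 1) X.Ljη X.αI X.κI ∧
      (∀ i : Fin 10, 2 ≤ i.val → i.val ≤ 4 → (X.term (X.R i)).IrrelevantBound X.𝒰 (X.CR i) X.Ljη X.αI X.κI) ∧
      (∀ i : Fin 10, 5 ≤ i.val → i.val ≤ 6 → (X.term (X.R i)).IrrelevantBound X.𝒰 (X.CR i) X.Ljη X.αI X.κI) ∧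
      (∀ i : Fin 10, 7 ≤ i.val → (X.term (X.R i)).IrrelevantBound X.𝒰 (X.CR i) X.Ljη X.αI X.κI) ∧
      Taylor430Printed X.coord X.fB X.dfB X.ddfB X.axisPart X.contour ∧
      Remainder430BoundPrinted X.b2 X.len X.α₁ X.Ljη X.β ∧
      Remainder430As422BetaPrinted (X.term (X.S 0)) X.𝒰 X.K422 X.β ∧
      (∀ i : Fin 6, 1 ≤ i.val → (X.term (X.S i)).IrrelevantBound X.𝒰 (X.CS i) X.Ljη X.αI X.κI) ∧
      HjFreeFactor290Printed X.h₀ X.h X.SH X.distH X.B₃ X.B₀ X.δ₀ X.M X.Ljη :=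
  ⟨fun h => ⟨h.1, h.2, h.3, h.4, h.5, h.6, h.7, h.8, h.9, h.10⟩,
    fun ⟨h1, h2, h3, h4, h5, h6, h7, h8, h9, h10⟩ => ⟨h1, h2, h3, h4, h5, h6, h7, h8, h9, h10⟩⟩

/-- **«The second sum can be bounded as in (4.22), hence it is irrelevant»** over the bundle: R₂ satisfies the (0.28)-predicate
with the (4.22) constant, exponent `4 + 1`, rate `κ∕3`. [cite: Balaban1987RG1, p.287 ll.14–15] -/
theorem Hyp.secondSum425_irrelevant (hX : Hyp X) :
    (X.term (X.R 0)).IrrelevantBound X.𝒰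
      ((32 * X.K422.B₃ * (X.K422.α₁ / X.K422.α₂) * X.K422.c₀ * X.K422.c₁) ^ 4) X.K422.Ljη 1 (X.K422.κ / 3) :=
  hX.secondSum425.irrelevantBound

/-- Every remainder R₃, …, R₁₁ of (4.29) (indices `1 ≤ i`) is irrelevant with its constant `CR i` — the three printed groups
of the bundle reassembled. [cite: Balaban1987RG1, (4.29) p.288 (bookkeeping)] -/
theorem Hyp.remainder429_irrelevant (hX : Hyp X) (i : Fin 10) (hi : 1 ≤ i.val) :
    (X.term (X.R i)).IrrelevantBound X.𝒰 (X.CR i) X.Ljη X.αI X.κI := by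
  by_cases h1 : i.val = 1
  · have : i = 1 := Fin.ext h1
    subst this
    exact hX.beforeLast425
  by_cases h4 : i.val ≤ 4
  · exact hX.irrelevant427 i (by omega) h4
  by_cases h6 : i.val ≤ 6
  · exact hX.irrelevant428 i (by omega) h6
  · exact hX.pointValues429 i (by omega)

/-- **«+ (the irrelevant terms). (4.29)»** over the bundle: the remainders R₃ + ⋯ + R₁₁ of `B12WTReduction429.eq429` add up to ONE
irrelevant term with constant `Σ_{1≤i} CR i` (R₂ carries the (4.22) constant, `Hyp.secondSum425_irrelevant`; R₁ is block 23's
(4.22)). [cite: Balaban1987RG1, (4.29) p.288 (bookkeeping)] -/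
theorem Hyp.remainders429_irrelevant (hX : Hyp X) :
    (X.term fun Y φ => ∑ i ∈ Finset.univ.filter (fun i : Fin 10 => 1 ≤ i.val), X.R i Y φ).IrrelevantBound X.𝒰
      (∑ i ∈ Finset.univ.filter (fun i : Fin 10 => 1 ≤ i.val), X.CR i) X.Ljη X.αI X.κI :=
  irrelevantBound_finsetSum X.sys X.R _ X.𝒰 X.CR X.Ljη X.αI X.κI
    fun i hi => hX.remainder429_irrelevant i (Finset.mem_filter.1 hi).2

/-- **«Hence this is an irrelevant term»** (p. 288) over the bundle: S₁ satisfies the (0.28)-predicate with the (4.22) constant,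
exponent `4 + β`, rate `κ∕3`, and `β > 0` (from `remainder430`). [cite: Balaban1987RG1, p.288 ll.23–27] -/
theorem Hyp.remainder430_irrelevant (hX : Hyp X) :
    0 < X.β ∧ (X.term (X.S 0)).IrrelevantBound X.𝒰
      ((32 * X.K422.B₃ * (X.K422.α₁ / X.K422.α₂) * X.K422.c₀ * X.K422.c₁) ^ 4) X.K422.Ljη X.β (X.K422.κ / 3) :=
  ⟨hX.remainder430.1, hX.remainder430As422.irrelevantBound⟩

/-- **«+ (the irrelevant terms). (4.31)»** over the bundle: S₂ + ⋯ + S₆ of `B12WTReduction429.eq431` add up to ONE irrelevant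
term with constant `Σ_{1≤i} CS i`. [cite: Balaban1987RG1, (4.31) p.289 (bookkeeping)] -/
theorem Hyp.remainders431_irrelevant (hX : Hyp X) :
    (X.term fun Y φ => ∑ i ∈ Finset.univ.filter (fun i : Fin 6 => 1 ≤ i.val), X.S i Y φ).IrrelevantBound X.𝒰
      (∑ i ∈ Finset.univ.filter (fun i : Fin 6 => 1 ≤ i.val), X.CS i) X.Ljη X.αI X.κI :=
  irrelevantBound_finsetSum X.sys X.S _ X.𝒰 X.CS X.Ljη X.αI X.κI
    fun i hi => hX.irrelevant431 i (Finset.mem_filter.1 hi).2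

/-- The p. 290 member in the binder shape `hdiff` of `B12HjFree290.kernelBound_restr_sub` ∕ `B12Chain290.replacement_error`
(`η = B₃·B₀e^{−δ₀M(L^jη)⁻¹}`); with `X.DomH`, `X.distH` instantiated to a domain class and the `distD` of a site geometry of
`B12Ext436`, `HjFreeFactor290Printed.kernelBound_restr_sub` delivers the tree's kernel bound by name. Reshaping only.
[cite: Balaban1987RG1, (4.35) p.290 ll.19–23] -/
theorem Hyp.hjFree_hdiff (hX : Hyp X) :
    ∀ Y, ∀ x ∈ X.SH, ‖X.h₀ Y x - X.h Y x‖ ≤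
      X.B₃ * (X.B₀ * Real.exp (-(X.δ₀ * (X.M * X.Ljη⁻¹)))) * Real.exp (-X.δ₀ * X.distH x Y) :=
  hX.hjFree290.hdiff

end Bookkeeping

/-! ## §4  A trivial inhabitant (the shape of the bundle is consistent; NOT a model of [I]) -/

/-- The one-domain system with `d_j = 0`. [cite: Balaban1987RG1, §0 p.257 (bookkeeping)] -/
def trivialSys : LocDomainSys where
  Dom := Unit
  dj := fun _ => 0
  dj_nonneg := fun _ => le_rfl

/-- All terms zero, all constants zero except `L^jη = 1`, `β = 1`; no points, no sites. [cite: Balaban1987RG1, (4.23)–(4.45)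
pp.286–292 (bookkeeping)] -/
def trivialCarriers : Carriers Unit ℂ Unit where
  sys := trivialSys
  𝒰 := Set.univ
  Ljη := 1
  αI := 1
  κI := 0
  K422 := ⟨0, 0, 0, 1, 0, 0, 0, 0, 1⟩
  R := fun _ _ _ => 0
  CR := fun _ => 0
  S := fun _ _ _ => 0
  CS := fun _ => 0
  β := 1
  P := Empty
  Bd := Empty
  coord := fun x => nomatch x
  axisPart := fun _ x => nomatch x
  contour := fun x => nomatch x
  fB := fun _ => ()
  dfB := fun _ _ => ()
  ddfB := fun _ _ => ()
  b2 := fun x => nomatch x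
  len := fun x => nomatch x
  α₁ := 0
  DomH := Unit
  ΛH := Empty
  h₀ := fun _ x => nomatch x
  h := fun _ x => nomatch x
  SH := ∅
  distH := fun x => nomatch x
  B₃ := 0
  B₀ := 0
  δ₀ := 0
  M := 0

/-- The trivial carriers satisfy the bundle (every term vanishes, every right member is `0` or vacuous).
[cite: Balaban1987RG1, (4.23)–(4.45) pp.286–292 (bookkeeping)] -/
theorem hyp_trivial : Hyp trivialCarriers where
  secondSum425 := by
    intro X φ _
    simp [trivialCarriers, KernelBound422Printed, Carriers.term]
  beforeLast425 := by intro X φ _; simp [trivialCarriers, Carriers.term]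
  irrelevant427 := by intro i _ _ X φ _; simp [trivialCarriers, Carriers.term]
  irrelevant428 := by intro i _ _ X φ _; simp [trivialCarriers, Carriers.term]
  pointValues429 := by intro i _ X φ _; simp [trivialCarriers, Carriers.term]
  taylor430 := fun x => nomatch x
  remainder430 := ⟨by show (0 : ℝ) < 1; norm_num, fun x => nomatch x⟩
  remainder430As422 := by intro X φ _; simp [trivialCarriers, Carriers.term]
  irrelevant431 := by intro i _ X φ _; simp [trivialCarriers, Carriers.term]
  hjFree290 := fun _ x => nomatch x

end Literature.MathematicalPhysics.QuantumFieldTheory.Balaban1983to89.B12Carve24Sect4PolarizationHyp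

end
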